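import Mathlib
import Literature.NumberTheory.LFunctions.Zhang2022.Section16ACalM2Analytic
import Literature.NumberTheory.LFunctions.Zhang2022.Section15Eq1523Edge
import HarnessLib

/-!
# Zhang (2022) §16 p. 91/92: the size of `ℳ₂(d,l;s)` near `s = 1` — `‖ℳ₂(d,l;s)‖ ≤ C·𝓛` for
# `dl < P²`, `|s − 1| ≤ 1/log P` (WP16 helper H6c for the repaired (16.10))

Topic `Literature/NumberTheory/LFunctions/Zhang2022` (Landau–Siegel audit tree; verdict-neutral).
Y. Zhang, *Discrete mean estimates and the Landau–Siegel zero*, arXiv:2211.02515v1 (2022)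
[Zhang2022LandauSiegel] — **an unrefereed manuscript under adjudication; nothing in this file asserts
or denies its Theorems 1–2.** §16 p. 91 (u021/u022: "`ℳ₂(d,l;s) ≪ ∏_{q∣dl}(1 + cq^{−9/10})` for
`σ > 9/10`") and (16.10) p. 92 ("in a way similar to the proof of (15.15) …", where the residue at the
exceptional zero `ρ̃` of `L(s,χ)` enters with the factor `ℳ₂(d,l;ρ̃)`, footnote "acceptable error" at
(15.15)). The product bound of u022 is uniform on `σ > 9/10` but, evaluated pointwise for `dl` near
`P`, as large as `exp(C𝓛^{0.9})`; near `σ = 1` the Euler factors at `q ∣ dl` are `1 + O(1/q)` instead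
of `1 + O(q^{−9/10})`, and the sharper bound below is what the repaired (16.10) (WP16-PLAN RT16-int-2)
consumes. PROVED, with no Assumption (A):

* `norm_calM2_le_rpow` — for every `D`, `χ`, `d, l ≥ 1` and `σ > 9/10`:
  `‖ℳ₂(d,l;s)‖ ≤ K·∏_{q∣dl}(1 + 900·q^{−σ})`, `K = exp(225·Σ'_q q^{−19/10})` (the `σ`-dependent form
  of `Section16ACalM2Analytic.norm_calM2_le`);
* (private) `prod_primeFactors_one_add_inv_le_self_div_totient`, `prod_primeFactors_one_add_div_le_pow`
  — `∏_{q∣n}(1 + 1/q) ≤ n/φ(n)` and `∏_{q∣n}(1 + c/q) ≤ (n/φ(n))^c` (`c ∈ ℕ`, Bernoulli);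
* **`calM2_near_one_le`** — `∃ C, ForAllLarge: ∀ d l ≥ 1, dl < P², ∀ s, ‖s − 1‖ ≤ 1/log P →
  ‖ℳ₂(d,l;s)‖ ≤ C·𝓛`: for `q ∣ dl` (`q < P²`) and `1 − σ ≤ 1/log P` one has `q^{−σ} ≤ e²/q`, so
  `∏_{q∣dl}(1 + 900q^{−σ}) ≤ ∏_{q∣dl}(1 + 6651/q) ≤ (dl/φ(dl))^{6651} ≤ (2 log log(dl))^{6651}`
  (Landau, the tree's `Ded1524.self_div_totient_le_two_mul_loglog`) `≤ (19 log 𝓛)^{6651} ≤ 𝓛` for all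
  large `D` (`log x = o(x^{1/6651})`).

Theorems only: no definition, no claim node, no named fact; axioms standard. WHAT THIS IS NOT: a proof
of (16.10) or of anything about Theorems 1–2 of the source or Landau–Siegel zeros.

## References

* Y. Zhang, arXiv:2211.02515v1 (2022), §16 p. 91 (u021, u022), p. 92 (16.10); §15 (15.15) p. 85.
  [cite: Zhang2022LandauSiegel, §16 p. 91]
* G. H. Hardy, E. M. Wright, *An Introduction to the Theory of Numbers*, Thm 328 (`φ(n) ≫ n/log log n`;
  the tree's `Literature.NumberTheory.Multiplicative.ExtremalOrder.eventually_le_totient_mul_loglog_div`).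
  [cite: HardyWright2008, Thm 328]
-/

noncomputable section

open Complex Real Filter Topology Asymptotics
open Literature.NumberTheory.LFunctions.Zhang2022
open Literature.NumberTheory.LFunctions.Zhang2022.Skeleton

namespace Literature.NumberTheory.LFunctions.Zhang2022.Typed.Section16A

/-! ## §1. `‖ℳ₂(d,l;s)‖ ≤ K·∏_{q∣dl}(1 + 900q^{−σ})` on `σ > 9/10` -/

/-- `‖∏_{i∈A} F i‖ ≤ ∏_{i∈A} (1 + ‖F i − 1‖)`. [folklore] -/
private theorem norm_prod_le_prod_one_add_norm_sub_one {ι : Type*} (A : Finset ι) (F : ι → ℂ) :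
    ‖∏ i ∈ A, F i‖ ≤ ∏ i ∈ A, (1 + ‖F i - 1‖) := by
  rw [norm_prod]
  refine Finset.prod_le_prod (fun i _ => norm_nonneg _) fun i _ => ?_
  calc ‖F i‖ = ‖(F i - 1) + 1‖ := by rw [sub_add_cancel]
    _ ≤ ‖F i - 1‖ + ‖(1 : ℂ)‖ := norm_add_le _ _
    _ = 1 + ‖F i - 1‖ := by rw [norm_one, add_comm]

/-- `∏_{i∈A} (1 + x i) ≤ exp (Σ_{i∈A} x i)` for `x ≥ 0`. [folklore] -/
private theorem prod_one_add_le_exp_sum {ι : Type*} (A : Finset ι) {x : ι → ℝ} (hx : ∀ i, 0 ≤ x i) :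
    ∏ i ∈ A, (1 + x i) ≤ Real.exp (∑ i ∈ A, x i) := by
  rw [Real.exp_sum]
  exact Finset.prod_le_prod (fun i _ => by linarith [hx i]) fun i _ => by
    linarith [Real.add_one_le_exp (x i)]

/-- `1 ≤ ∏_{i∈s} f i` when every `f i ≥ 1` (real version). [folklore] -/
private theorem one_le_prod_real {ι : Type*} (s : Finset ι) {f : ι → ℝ} (h : ∀ i ∈ s, 1 ≤ f i) :
    1 ≤ ∏ i ∈ s, f i :=
  calc (1 : ℝ) = ∏ _i ∈ s, (1 : ℝ) := Finset.prod_const_one.symm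
    _ ≤ ∏ i ∈ s, f i := Finset.prod_le_prod (fun _ _ => zero_le_one) h

/-- A sub-product of factors `≥ 1` is bounded by the full product (real version). [folklore] -/
private theorem prod_le_prod_of_subset_of_one_le_real {ι : Type*} [DecidableEq ι] {s t : Finset ι}
    (hst : s ⊆ t) {f : ι → ℝ} (h1 : ∀ i ∈ t, 1 ≤ f i) : ∏ i ∈ s, f i ≤ ∏ i ∈ t, f i := by
  rw [← Finset.prod_sdiff hst]
  have hs0 : 0 ≤ ∏ i ∈ s, f i := Finset.prod_nonneg fun i hi => zero_le_one.trans (h1 i (hst hi))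
  have h := one_le_prod_real (t \ s) (f := f) fun i hi => h1 i (Finset.mem_sdiff.mp hi).1
  exact le_mul_of_one_le_left hs0 h

section CalM2

variable (c' : ℝ) {D : ℕ} [NeZero D] (χ : DirichletCharacter ℂ D)

/-- **`‖ℳ₂(d,l;s)‖ ≤ K·∏_{q∣dl}(1 + 900·q^{−σ})`** for `σ > 9/10`, `d, l ≥ 1`, every `D`, `χ`, with
`K = exp(225·Σ'_q q^{−19/10})`: the `σ`-dependent form of `norm_calM2_le` (local bounds
`‖F_q − 1‖ ≤ 225q^{−σ}/q ≤ 225q^{−19/10}` for `q ∤ dl` and `≤ 900q^{−σ}` for `q ∣ dl`; every partial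
product is `≤ ∏(1 + ‖F_q − 1‖)`, and the bound passes to the limit). [cite: Zhang2022LandauSiegel, §16 p. 91] -/
theorem norm_calM2_le_rpow {d l : ℕ} (hd : 1 ≤ d) (hl : 1 ≤ l) {s : ℂ} (hs : 9 / 10 < s.re) :
    ‖calM2 c' χ d l s‖ ≤
      Real.exp (225 * ∑' q : Nat.Primes, ((q : ℕ) : ℝ) ^ (-(19 / 10 : ℝ))) *
        ∏ q ∈ (d * l).primeFactors, (1 + 900 * (q : ℝ) ^ (-s.re)) := by
  classical
  have hdl0 : 0 < d * l := Nat.mul_pos hd hl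
  obtain ⟨hmul, -⟩ := calM2_multipliable_differentiableOn c' χ hd hl
  -- the global majorant over the primes and the global constant
  set x : Nat.Primes → ℝ := fun q => 225 * ((q : ℕ) : ℝ) ^ (-(19 / 10 : ℝ)) with hxdef
  have hx0 : ∀ q, 0 ≤ x q := fun q => by positivity
  have hxsum : Summable x := by
    have h : Summable fun n : ℕ => (n : ℝ) ^ (-(19 / 10 : ℝ)) :=
      Real.summable_nat_rpow.mpr (by norm_num)
    exact (h.comp_injective Subtype.val_injective).mul_left 225
  set K : ℝ := Real.exp (225 * ∑' q : Nat.Primes, ((q : ℕ) : ℝ) ^ (-(19 / 10 : ℝ))) with hK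
  have hKx : Real.exp (∑' q, x q) = K := by
    rw [hK, hxdef, tsum_mul_left]
  set F : Nat.Primes → ℂ := fun q => calM2Factor c' χ (q : ℕ) d l s with hF
  have hHP : HasProd F (calM2 c' χ d l s) := (hmul s hs).hasProd
  -- the local majorants
  set y : Nat.Primes → ℝ := fun q =>
    if (q : ℕ) ∣ d * l then 900 * ((q : ℕ) : ℝ) ^ (-s.re) else 0 with hydef
  have hy0 : ∀ q, 0 ≤ y q := fun q => by
    have hq0 : (0 : ℝ) < ((q : ℕ) : ℝ) := by exact_mod_cast q.prop.pos
    simp only [hydef]; split_ifs <;> positivity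
  have hFb : ∀ q : Nat.Primes, ‖F q - 1‖ ≤ x q + y q := by
    intro q
    have hqprime : (q : ℕ).Prime := q.prop
    have hq0 : (0 : ℝ) < ((q : ℕ) : ℝ) := by exact_mod_cast hqprime.pos
    have hq1 : (1 : ℝ) ≤ ((q : ℕ) : ℝ) := by exact_mod_cast hqprime.one_lt.le
    by_cases hc : Nat.Coprime (q : ℕ) (d * l)
    · have h := norm_calM2Factor_sub_one_le_of_coprime c' χ hqprime hc hs.le
      have h1 : ((q : ℕ) : ℝ) ^ (-s.re) ≤ ((q : ℕ) : ℝ) ^ (-(9 / 10 : ℝ)) :=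
        Real.rpow_le_rpow_of_exponent_le hq1 (by linarith)
      have h2 : ((q : ℕ) : ℝ) ^ (-(19 / 10 : ℝ)) = ((q : ℕ) : ℝ) ^ (-(9 / 10 : ℝ)) / (q : ℕ) := by
        rw [← Real.rpow_sub_one hq0.ne']; norm_num
      have h' : ‖F q - 1‖ ≤ x q :=
        calc _ ≤ 225 * ((q : ℕ) : ℝ) ^ (-s.re) / (q : ℕ) := h
          _ = 225 * (((q : ℕ) : ℝ) ^ (-s.re) / (q : ℕ)) := by ring
          _ ≤ 225 * (((q : ℕ) : ℝ) ^ (-(9 / 10 : ℝ)) / (q : ℕ)) := by gcongr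
          _ = x q := by
              show _ = 225 * ((q : ℕ) : ℝ) ^ (-(19 / 10 : ℝ))
              rw [h2]
      linarith [hy0 q]
    · have h := norm_calM2Factor_sub_one_le c' χ hqprime d l hs.le
      have hdvd : (q : ℕ) ∣ d * l := not_not.mp (mt hqprime.coprime_iff_not_dvd.mpr hc)
      have h' : ‖F q - 1‖ ≤ y q := by
        simp only [hydef, if_pos hdvd]; exact h
      linarith [hx0 q]
  -- the target bound
  set Pdl : ℝ := ∏ q ∈ (d * l).primeFactors, (1 + 900 * (q : ℝ) ^ (-s.re)) with hPdl
  set B : ℝ := K * Pdl with hB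
  have hAll : ∀ A : Finset Nat.Primes, ‖∏ q ∈ A, F q‖ ≤ B := by
    intro A
    have h1 : ‖∏ q ∈ A, F q‖ ≤ ∏ q ∈ A, (1 + (x q + y q)) :=
      (norm_prod_le_prod_one_add_norm_sub_one A F).trans
        (Finset.prod_le_prod (fun q _ => by positivity) fun q _ => by linarith [hFb q])
    have h2 : ∏ q ∈ A, (1 + (x q + y q)) ≤ (∏ q ∈ A, (1 + x q)) * ∏ q ∈ A, (1 + y q) := by
      rw [← Finset.prod_mul_distrib]
      exact Finset.prod_le_prod (fun q _ => by linarith [hx0 q, hy0 q]) fun q _ => by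
        nlinarith [hx0 q, hy0 q]
    have h3 : ∏ q ∈ A, (1 + x q) ≤ K := by
      refine (prod_one_add_le_exp_sum A hx0).trans ?_
      rw [← hKx]
      exact Real.exp_le_exp.mpr (hxsum.sum_le_tsum A fun q _ => hx0 q)
    have h4 : ∏ q ∈ A, (1 + y q) ≤ Pdl := by
      set g : ℕ → ℝ := fun n => 1 + 900 * (n : ℝ) ^ (-s.re) with hg
      have hg1 : ∀ n, 1 ≤ g n := fun n => by
        have : 0 ≤ 900 * (n : ℝ) ^ (-s.re) := by positivity
        simp only [hg]; linarith
      set A' : Finset Nat.Primes := A.filter (fun q : Nat.Primes => (q : ℕ) ∣ d * l) with hA'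
      have hrw : ∏ q ∈ A, (1 + y q) = ∏ q ∈ A', g q := by
        rw [hA', Finset.prod_filter]
        refine Finset.prod_congr rfl fun q _ => ?_
        by_cases hqd : (q : ℕ) ∣ d * l
        · simp only [hydef, hg, if_pos hqd]
        · simp only [hydef, hg, if_neg hqd, add_zero]
      have himg : ∏ n ∈ A'.image (fun q : Nat.Primes => (q : ℕ)), g n = ∏ q ∈ A', g q :=
        Finset.prod_image fun q _ q' _ h => Subtype.val_injective h
      have hsub : A'.image (fun q : Nat.Primes => (q : ℕ)) ⊆ (d * l).primeFactors := by
        intro n hn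
        obtain ⟨q, hq', rfl⟩ := Finset.mem_image.mp hn
        exact Nat.mem_primeFactors.mpr ⟨q.prop, (Finset.mem_filter.mp hq').2, hdl0.ne'⟩
      calc ∏ q ∈ A, (1 + y q) = ∏ q ∈ A', g q := hrw
        _ = ∏ n ∈ A'.image (fun q : Nat.Primes => (q : ℕ)), g n := himg.symm
        _ ≤ ∏ n ∈ (d * l).primeFactors, g n :=
            prod_le_prod_of_subset_of_one_le_real hsub fun n _ => hg1 n
        _ = Pdl := by rw [hPdl]
    have hK0 : 0 ≤ K := (Real.exp_pos _).le
    have hP1 : 0 ≤ ∏ q ∈ A, (1 + y q) := Finset.prod_nonneg fun q _ => by linarith [hy0 q]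
    calc ‖∏ q ∈ A, F q‖ ≤ (∏ q ∈ A, (1 + x q)) * ∏ q ∈ A, (1 + y q) := h1.trans h2
      _ ≤ K * Pdl := mul_le_mul h3 h4 hP1 hK0
  -- pass to the limit of the unconditional product
  have hT : Tendsto (fun A : Finset Nat.Primes => ∏ q ∈ A, F q) atTop (𝓝 (calM2 c' χ d l s)) := hHP
  have hclosed : IsClosed {z : ℂ | ‖z‖ ≤ B} := isClosed_le continuous_norm continuous_const
  have hmem := hclosed.mem_of_tendsto hT (Filter.Eventually.of_forall hAll)
  simpa only [hB, hPdl, Set.mem_setOf_eq] using hmem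

end CalM2

/-! ## §2. `∏_{q∣n}(1 + c/q) ≤ (n/φ(n))^c` -/

/-- **`∏_{q∣n}(1 + 1/q) ≤ n/φ(n)`** (`n ≥ 1`): `n/φ(n) = ∏_{q∣n} q/(q−1)` and `1 + 1/q ≤ q/(q−1)`.
[folklore] -/
private theorem prod_primeFactors_one_add_inv_le_self_div_totient {n : ℕ} (hn : n ≠ 0) :
    ∏ q ∈ n.primeFactors, (1 + (q : ℝ)⁻¹) ≤ (n : ℝ) / Nat.totient n := by
  have hφ : (0 : ℝ) < Nat.totient n := by exact_mod_cast Nat.totient_pos.mpr (Nat.pos_of_ne_zero hn)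
  have key := Nat.totient_mul_prod_primeFactors n
  -- cast to `ℝ`: `φ(n)·∏ q = n·∏ (q − 1)`
  have hcast : (Nat.totient n : ℝ) * ∏ q ∈ n.primeFactors, (q : ℝ) =
      (n : ℝ) * ∏ q ∈ n.primeFactors, ((q : ℝ) - 1) := by
    have h := congrArg (fun m : ℕ => (m : ℝ)) key
    simp only [Nat.cast_mul, Nat.cast_prod] at h
    rw [h]
    congr 1
    refine Finset.prod_congr rfl fun q hq => ?_
    rw [Nat.cast_sub (Nat.prime_of_mem_primeFactors hq).one_lt.le, Nat.cast_one]
  have hP1 : 0 < ∏ q ∈ n.primeFactors, ((q : ℝ) - 1) :=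
    Finset.prod_pos fun q hq => by
      have h2 : (2 : ℝ) ≤ q := by exact_mod_cast (Nat.prime_of_mem_primeFactors hq).two_le
      linarith
  -- `∏(1 + 1/q) · ∏(q−1) ≤ ∏ q`, i.e. termwise `(1 + 1/q)(q − 1) = q − 1/q ≤ q`
  have hterm : (∏ q ∈ n.primeFactors, (1 + (q : ℝ)⁻¹)) * ∏ q ∈ n.primeFactors, ((q : ℝ) - 1) ≤
      ∏ q ∈ n.primeFactors, (q : ℝ) := by
    rw [← Finset.prod_mul_distrib]
    refine Finset.prod_le_prod (fun q hq => ?_) fun q hq => ?_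
    · have h2 : (2 : ℝ) ≤ q := by exact_mod_cast (Nat.prime_of_mem_primeFactors hq).two_le
      have : 0 ≤ (q : ℝ)⁻¹ := by positivity
      nlinarith
    · have h2 : (2 : ℝ) ≤ q := by exact_mod_cast (Nat.prime_of_mem_primeFactors hq).two_le
      have hq0 : (0 : ℝ) < q := by linarith
      have e : (1 + (q : ℝ)⁻¹) * ((q : ℝ) - 1) = q - (q : ℝ)⁻¹ := by field_simp; ring
      rw [e]
      have : 0 ≤ (q : ℝ)⁻¹ := by positivity
      linarith
  rw [le_div_iff₀ hφ]
  -- multiply the goal by the positive `∏ (q − 1)`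
  have h := mul_le_mul_of_nonneg_left hterm hφ.le
  calc (∏ q ∈ n.primeFactors, (1 + (q : ℝ)⁻¹)) * Nat.totient n
      = ((Nat.totient n : ℝ) * ((∏ q ∈ n.primeFactors, (1 + (q : ℝ)⁻¹)) *
          ∏ q ∈ n.primeFactors, ((q : ℝ) - 1))) / ∏ q ∈ n.primeFactors, ((q : ℝ) - 1) := by
        field_simp
    _ ≤ ((Nat.totient n : ℝ) * ∏ q ∈ n.primeFactors, (q : ℝ)) /
          ∏ q ∈ n.primeFactors, ((q : ℝ) - 1) := by gcongr
    _ = (n : ℝ) := by rw [hcast, mul_div_assoc, div_self hP1.ne', mul_one]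

/-- **`∏_{q∣n}(1 + c/q) ≤ (n/φ(n))^c`** for a natural number `c` (`n ≥ 1`): Bernoulli
`1 + c/q ≤ (1 + 1/q)^c` and the previous lemma. [folklore] -/
private theorem prod_primeFactors_one_add_div_le_pow {n : ℕ} (hn : n ≠ 0) (c : ℕ) :
    ∏ q ∈ n.primeFactors, (1 + (c : ℝ) / q) ≤ ((n : ℝ) / Nat.totient n) ^ c := by
  have h1 : ∏ q ∈ n.primeFactors, (1 + (c : ℝ) / q) ≤ ∏ q ∈ n.primeFactors, (1 + (q : ℝ)⁻¹) ^ c := by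
    refine Finset.prod_le_prod (fun q _ => by positivity) fun q _ => ?_
    have hq : (-2 : ℝ) ≤ (q : ℝ)⁻¹ := by
      have : (0 : ℝ) ≤ (q : ℝ)⁻¹ := by positivity
      linarith
    have h := one_add_mul_le_pow hq c
    rw [div_eq_mul_inv]
    exact h
  rw [Finset.prod_pow] at h1
  exact h1.trans (pow_le_pow_left₀ (Finset.prod_nonneg fun q _ => by positivity)
    (prod_primeFactors_one_add_inv_le_self_div_totient hn) c)

/-! ## §3. `ℳ₂(d,l;s)` near `s = 1` -/

section NearOne

variable (c' : ℝ)

/-- `e² < 7.39`. [folklore] -/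
private theorem exp_two_lt : Real.exp 2 < 7.39 := by
  have h1 : Real.exp 1 < 2.7182818286 := Real.exp_one_lt_d9
  have h2 : Real.exp 2 = Real.exp 1 * Real.exp 1 := by rw [← Real.exp_add]; norm_num
  rw [h2]
  nlinarith [Real.exp_pos (1 : ℝ)]

/-- **The local factor at `q ∣ dl` near `s = 1`**: if `q ≤ dl < P²` and `‖s − 1‖ ≤ 1/log P`
(`log P = 𝓛⁹ > 0`), then `q^{−σ} = q^{−1}q^{1−σ} ≤ e²/q`, so `900·q^{−σ} ≤ 6651/q`.
[cite: Zhang2022LandauSiegel, §16 (16.10) p. 92] -/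
theorem local_rpow_le_near_one {D q n : ℕ} (hq : q.Prime) (hqn : q ∣ n) (hn0 : n ≠ 0)
    (hnP : (n : ℝ) < bigP D ^ 2) (hℓ : 1 ≤ ell D) {s : ℂ} (hs : ‖s - 1‖ ≤ 1 / Real.log (bigP D)) :
    900 * (q : ℝ) ^ (-s.re) ≤ (6651 : ℝ) / q := by
  have hq0 : (0 : ℝ) < q := by exact_mod_cast hq.pos
  have hq2 : (2 : ℝ) ≤ q := by exact_mod_cast hq.two_le
  have hℓ9 : (1 : ℝ) ≤ ell D ^ 9 := one_le_pow₀ hℓ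
  have hlogP : Real.log (bigP D) = ell D ^ 9 := by rw [bigP, Real.log_exp]
  rw [hlogP] at hs
  -- `1 − σ ≤ 1/𝓛⁹`
  have hσ : 1 - s.re ≤ 1 / ell D ^ 9 := by
    have h := Complex.abs_re_le_norm (s - 1)
    rw [Complex.sub_re, Complex.one_re] at h
    have := (abs_le.mp (h.trans hs)).1
    linarith
  -- `log q ≤ 2𝓛⁹`
  have hqn' : (q : ℝ) ≤ n := by exact_mod_cast Nat.le_of_dvd (Nat.pos_of_ne_zero hn0) hqn
  have hlogq : Real.log q ≤ 2 * ell D ^ 9 := by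
    have hP2 : bigP D ^ 2 = Real.exp (2 * ell D ^ 9) := by
      rw [bigP, ← Real.exp_nat_mul]; norm_num
    have h1 : (q : ℝ) < Real.exp (2 * ell D ^ 9) := by rw [← hP2]; linarith
    have h2 : Real.log q < 2 * ell D ^ 9 := by
      rw [Real.log_lt_iff_lt_exp hq0]; exact h1
    exact h2.le
  have hlogq0 : 0 ≤ Real.log q := Real.log_nonneg (by linarith)
  -- `q^{1−σ} ≤ e²`
  have hpow : (q : ℝ) ^ (1 - s.re) ≤ Real.exp 2 := by
    rw [Real.rpow_def_of_pos hq0]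
    refine Real.exp_le_exp.mpr ?_
    calc Real.log q * (1 - s.re) ≤ Real.log q * (1 / ell D ^ 9) :=
          mul_le_mul_of_nonneg_left hσ hlogq0
      _ ≤ (2 * ell D ^ 9) * (1 / ell D ^ 9) := by
          gcongr
      _ = 2 := by field_simp
  -- `q^{−σ} = q^{−1}·q^{1−σ}`
  have hsplit : (q : ℝ) ^ (-s.re) = (q : ℝ)⁻¹ * (q : ℝ) ^ (1 - s.re) := by
    rw [← Real.rpow_neg_one, ← Real.rpow_add hq0]; congr 1; ring
  rw [hsplit]
  have he := exp_two_lt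
  calc 900 * ((q : ℝ)⁻¹ * (q : ℝ) ^ (1 - s.re)) = 900 * (q : ℝ) ^ (1 - s.re) / q := by
        field_simp
    _ ≤ 900 * 7.39 / q := by gcongr; linarith
    _ = 6651 / q := by norm_num

/-- `M ≤ 𝓛` once `D ≥ ⌈e^M⌉`. [cite: Zhang2022LandauSiegel, §2 p. 4] -/
private theorem le_ell_of_ceil_exp_le {M : ℝ} {D : ℕ} (hD : ⌈Real.exp M⌉₊ ≤ D) : M ≤ ell D := by
  have h1 : Real.exp M ≤ D := (Nat.le_ceil _).trans (by exact_mod_cast hD)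
  have hD0 : (0 : ℝ) < D := lt_of_lt_of_le (Real.exp_pos M) h1
  rw [ell, Real.le_log_iff_exp_le hD0]
  exact h1

/-- **`ℳ₂(d,l;s)` near `s = 1` (WP16 helper H6c)**: there is an absolute `C` such that for all large
`D`, all `d, l ≥ 1` with `dl < P²` and all `s` with `‖s − 1‖ ≤ 1/log P`,
`‖ℳ₂(d,l;s)‖ ≤ C·𝓛` (`𝓛 = log D`): the factors at `q ∤ dl` contribute `≤ K` (as on `σ > 9/10`), those
at `q ∣ dl` are `1 + O(1/q)` there (`q^{−σ} ≤ e²/q`), and `∏_{q∣dl}(1 + 6651/q) ≤ (dl/φ(dl))^{6651} ≤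
(2 log log(dl))^{6651} ≤ (19 log 𝓛)^{6651} ≤ 𝓛` eventually (Landau's `φ(n) ≥ n/(2 log log n)`, the
tree's `Ded1524.self_div_totient_le_two_mul_loglog`; `log x = o(x^{1/6651})`). This is the polylog
size the repaired (16.10) uses for the residue at the exceptional zero.
[cite: Zhang2022LandauSiegel, §16 (16.10) p. 92] -/
theorem calM2_near_one_le : ∃ C : ℝ, ForAllLarge fun D _ χ => ∀ d l : ℕ, 1 ≤ d → 1 ≤ l →
    ((d * l : ℕ) : ℝ) < bigP D ^ 2 → ∀ s : ℂ, ‖s - 1‖ ≤ 1 / Real.log (bigP D) →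
      ‖calM2 c' χ d l s‖ ≤ C * ell D := by
  classical
  -- Landau: `n/φ(n) ≤ 2 log log n` for `n ≥ D₁`
  obtain ⟨D₁, hD₁⟩ := Ded1524.self_div_totient_le_two_mul_loglog
  -- `log x = o(x^{1/6651})`: `19 log x ≤ x^{1/6651}` for `x ≥ X₀`
  have hlo := isLittleO_log_rpow_atTop (show (0 : ℝ) < 1 / 6651 by norm_num)
  obtain ⟨X₀, hX₀⟩ := Filter.eventually_atTop.mp (hlo.def (show (0 : ℝ) < 1 / 19 by norm_num))
  set K : ℝ := Real.exp (225 * ∑' q : Nat.Primes, ((q : ℕ) : ℝ) ^ (-(19 / 10 : ℝ))) with hK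
  have hK0 : 0 ≤ K := (Real.exp_pos _).le
  set L₀ : ℝ := max (max X₀ 2) (Real.exp ((D₁ : ℝ) + 2)) with hL₀
  refine ⟨K, ⌈Real.exp L₀⌉₊, fun D _ χ hD _ _ d l hd hl hdlP s hs => ?_⟩
  have hℓL : L₀ ≤ ell D := le_ell_of_ceil_exp_le hD
  have hℓX : X₀ ≤ ell D := le_trans (le_trans (le_max_left _ _) (le_max_left _ _)) hℓL
  have hℓ2 : 2 ≤ ell D := le_trans (le_trans (le_max_right _ _) (le_max_left _ _)) hℓL
  have hℓE : Real.exp ((D₁ : ℝ) + 2) ≤ ell D := le_trans (le_max_right _ _) hℓL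
  have hℓ1 : 1 ≤ ell D := by linarith
  have hℓ0 : 0 < ell D := by linarith
  set n : ℕ := d * l with hn
  have hn0 : n ≠ 0 := (Nat.mul_pos hd hl).ne'
  -- `σ > 9/10`
  have hlogP : Real.log (bigP D) = ell D ^ 9 := by rw [bigP, Real.log_exp]
  have hℓ9 : (512 : ℝ) ≤ ell D ^ 9 := by
    have : (2 : ℝ) ^ 9 ≤ ell D ^ 9 := by gcongr
    norm_num at this; exact this
  have hσ : 9 / 10 < s.re := by
    have h := Complex.abs_re_le_norm (s - 1)
    rw [Complex.sub_re, Complex.one_re] at h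
    rw [hlogP] at hs
    have h1 : |s.re - 1| ≤ 1 / ell D ^ 9 := h.trans hs
    have h2 : 1 / ell D ^ 9 ≤ 1 / 512 := one_div_le_one_div_of_le (by norm_num) hℓ9
    have := (abs_le.mp (h1.trans h2)).1
    linarith
  -- the Euler product bound with the near-one local factors
  have hM := norm_calM2_le_rpow c' χ hd hl hσ
  have hprod : ∏ q ∈ n.primeFactors, (1 + 900 * (q : ℝ) ^ (-s.re)) ≤
      ∏ q ∈ n.primeFactors, (1 + ((6651 : ℕ) : ℝ) / q) := by
    refine Finset.prod_le_prod (fun q _ => by positivity) fun q hq => ?_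
    have hqp := Nat.prime_of_mem_primeFactors hq
    have h := local_rpow_le_near_one hqp (Nat.dvd_of_mem_primeFactors hq) hn0 hdlP hℓ1 hs
    push_cast
    linarith
  have hpow := prod_primeFactors_one_add_div_le_pow hn0 6651
  -- `n/φ(n) ≤ 19 log 𝓛`
  have hlogℓ : (D₁ : ℝ) + 2 ≤ Real.log (ell D) := by
    rw [Real.le_log_iff_exp_le hℓ0]; exact hℓE
  have hφn : (n : ℝ) / Nat.totient n ≤ 19 * Real.log (ell D) := by
    by_cases hnD : D₁ ≤ n
    · have h1 := hD₁ n hnD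
      -- `log log n ≤ log (2𝓛⁹) ≤ 1 + 9 log 𝓛`
      have hnpos : (0 : ℝ) < n := by exact_mod_cast Nat.pos_of_ne_zero hn0
      have hlogn : Real.log n < 2 * ell D ^ 9 := by
        have hP2 : bigP D ^ 2 = Real.exp (2 * ell D ^ 9) := by
          rw [bigP, ← Real.exp_nat_mul]; norm_num
        rw [Real.log_lt_iff_lt_exp hnpos, ← hP2]; exact hdlP
      have hloglog : Real.log (ell n) ≤ Real.log (2 * ell D ^ 9) := by
        rw [ell]
        rcases eq_or_lt_of_le (Real.log_natCast_nonneg n) with h0 | hpos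
        · rw [← h0, Real.log_zero]; exact Real.log_nonneg (by linarith)
        · exact Real.log_le_log hpos hlogn.le
      have hlog2ℓ : Real.log (2 * ell D ^ 9) ≤ 1 + 9 * Real.log (ell D) := by
        rw [Real.log_mul (by norm_num) (by positivity), Real.log_pow]
        have := Real.log_two_lt_d9
        push_cast
        linarith
      calc (n : ℝ) / Nat.totient n ≤ 2 * Real.log (ell n) := h1
        _ ≤ 2 * (1 + 9 * Real.log (ell D)) := by linarith
        _ ≤ 19 * Real.log (ell D) := by linarith
    · -- `n < D₁`: `n/φ(n) ≤ n ≤ D₁ ≤ log 𝓛`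
      have hφ1 : (1 : ℝ) ≤ Nat.totient n := by
        exact_mod_cast Nat.totient_pos.mpr (Nat.pos_of_ne_zero hn0)
      have hnD' : (n : ℝ) ≤ D₁ := by exact_mod_cast (not_le.mp hnD).le
      have hn0' : (0 : ℝ) ≤ n := Nat.cast_nonneg n
      calc (n : ℝ) / Nat.totient n ≤ n := div_le_self hn0' hφ1
        _ ≤ D₁ := hnD'
        _ ≤ 19 * Real.log (ell D) := by linarith
  -- `(19 log 𝓛)^{6651} ≤ 𝓛`
  have hsmall : (19 * Real.log (ell D)) ^ 6651 ≤ ell D := by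
    have h := hX₀ (ell D) hℓX
    rw [Real.norm_eq_abs, Real.norm_eq_abs, abs_of_nonneg (Real.log_nonneg hℓ1),
      abs_of_nonneg (Real.rpow_nonneg hℓ0.le _)] at h
    have h19 : 19 * Real.log (ell D) ≤ ell D ^ (1 / 6651 : ℝ) := by linarith
    have h0 : 0 ≤ 19 * Real.log (ell D) := by
      have := Real.log_nonneg hℓ1; positivity
    calc (19 * Real.log (ell D)) ^ 6651 ≤ (ell D ^ (1 / 6651 : ℝ)) ^ 6651 :=
          pow_le_pow_left₀ h0 h19 6651
      _ = ell D := by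
          rw [← Real.rpow_natCast, ← Real.rpow_mul hℓ0.le]; norm_num
  have hφ0 : 0 ≤ (n : ℝ) / Nat.totient n := by positivity
  calc ‖calM2 c' χ d l s‖ ≤ K * ∏ q ∈ n.primeFactors, (1 + 900 * (q : ℝ) ^ (-s.re)) := hM
    _ ≤ K * ∏ q ∈ n.primeFactors, (1 + ((6651 : ℕ) : ℝ) / q) := by gcongr
    _ ≤ K * ((n : ℝ) / Nat.totient n) ^ 6651 := by gcongr
    _ ≤ K * (19 * Real.log (ell D)) ^ 6651 := by gcongr
    _ ≤ K * ell D := by gcongr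

end NearOne

end Literature.NumberTheory.LFunctions.Zhang2022.Typed.Section16A
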